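import Mathlib
import HarnessLib
import Summits.ValiantsHypothesis.ValiantsHypothesis.Theorems.KPlusLogSqLawWeakLiftingTowerGraftWronskianKFourSpreadSixACert

/-!
# Tower graft line — CONJECTURE W AT `K = 4` ON THE SUPPORTS `(c, c+3h, c+4h, c+6h)` AND MIRRORS `(c, c+2h, c+3h, c+6h)` (first spread-6 shape)

Helper file for LINE (B) `Cruxes/WeakLifting/Lines/tower_graft.lean` (crux `WeakLifting` = stmt-ValiantsHypothesis-19561), target (W-4) =
`ConjectureWAt 4`.  NO stub is claimed; `ConjectureWAt 4` stays OPEN in general.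
On `d = (c, c+3, c+4, c+6)`: `X·W(u,v) = X^{2c+3}·Q`, `Q` a septic with vanishing `X²`, `X⁵` coefficients `(3p₀₁, 4p₀₂, 0, 6p₀₃, p₁₂, 0, 3p₁₃,
2p₂₃)`; five distinct positive zeros give `Q = (∏(X − rᵢ))·(c₂X² + c₁X + c₀)` (coefficients compared), and `…KFourSpreadSixACert.spreadSixA_algebra`
(vanishing coefficients ⇒ `(c₀,c₁,c₂) ∥ (e₂e₄−e₁e₅, e₂e₃−e₅, e₁e₃−e₄)`; weighted Plücker ⇒ `t²R(e) = 0`; `−R > 0` by the LP-found Newton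
certificate) closes the case `p₂₃ ≠ 0`; `p₂₃ = 0` is a vanishing top coefficient (`…KFourAlternating`).
* ★★ `card_posRoots_wronskian_four_le_four_spreadSixA` (`(c, c+3, c+4, c+6)`), `_scaled` (`(c, c+3h, c+4h, c+6h)`), `_mirror` (`(c, c+2h, c+3h, c+6h)`).
HONEST FRAMING: one more support family (the first of spread 6); nothing on S4/S4f/S5/S5ᴸ, TowerB, `WeakLifting`, Conjecture B,
`MatrixDescartes` (18050), `VP ≠ VNP`.  Def-free.  Seat: prover leafhand-val-kpluslogsqlaw-1 g12, `--supports stmt-ValiantsHypothesis-19561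
--as helper`.  [Vieta; this work]
-/

-- `Summit.ValiantsHypothesis.ValiantsHypothesis.…` repeats a component by the D-0017 layout
-- (single-conjunct summit), which the `dupNamespace` linter flags; the name is mandated.
set_option linter.dupNamespace false
set_option autoImplicit false

namespace Summit.ValiantsHypothesis.ValiantsHypothesis.Theorems.KPlusLogSqLaw.TowerGraft

open Polynomial Finset
open scoped BigOperators Polynomial

namespace WronskianDevelopable

/-! ## The family `d = (c, c+3, c+4, c+6)` -/

/-- `X·W(u,v) = X^{2c+3}·Q` with `Q` the septic `3p₀₁ + 4p₀₂X + 6p₀₃X³ + p₁₂X⁴ + 3p₁₃X⁶ + 2p₂₃X⁷`. [this work] -/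
theorem X_mul_wronskian_spreadSixA_eq (u v : Fin 4 → ℝ) (c : ℕ) :
    (X : ℝ[X]) * wronskian (∑ l, C (u l) * (X : ℝ[X]) ^ (![c, c + 3, c + 4, c + 6] : Fin 4 → ℕ) l)
        (∑ l, C (v l) * (X : ℝ[X]) ^ (![c, c + 3, c + 4, c + 6] : Fin 4 → ℕ) l) =
      X ^ (2 * c + 3) *
        (C ((u 0 * v 1 - u 1 * v 0) * 3) + C ((u 0 * v 2 - u 2 * v 0) * 4) * X + C ((u 0 * v 3 - u 3 * v 0) * 6) * X ^ 3 +
          C (u 1 * v 2 - u 2 * v 1) * X ^ 4 + C ((u 1 * v 3 - u 3 * v 1) * 3) * X ^ 6 + C ((u 2 * v 3 - u 3 * v 2) * 2) * X ^ 7) := by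
  rw [X_mul_wronskian_four_eq]
  simp only [Matrix.cons_val_zero, Matrix.cons_val_one, Matrix.cons_val]
  push_cast
  have e1 : (X : ℝ[X]) ^ (c + (c + 3)) = X ^ (2 * c + 3) := by ring_nf
  have e2 : (X : ℝ[X]) ^ (c + (c + 4)) = X ^ (2 * c + 3) * X := by ring_nf
  have e3 : (X : ℝ[X]) ^ (c + (c + 6)) = X ^ (2 * c + 3) * X ^ 3 := by ring_nf
  have e4 : (X : ℝ[X]) ^ (c + 3 + (c + 4)) = X ^ (2 * c + 3) * X ^ 4 := by ring_nf
  have e5 : (X : ℝ[X]) ^ (c + 3 + (c + 6)) = X ^ (2 * c + 3) * X ^ 6 := by ring_nf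
  have e6 : (X : ℝ[X]) ^ (c + 4 + (c + 6)) = X ^ (2 * c + 3) * X ^ 7 := by ring_nf
  rw [e1, e2, e3, e4, e5, e6]
  have n1 : ((c : ℝ) + 3 - c) = 3 := by ring
  have n2 : ((c : ℝ) + 4 - c) = 4 := by ring
  have n3 : ((c : ℝ) + 6 - c) = 6 := by ring
  have n4 : ((c : ℝ) + 4 - (c + 3)) = 1 := by ring
  have n5 : ((c : ℝ) + 6 - (c + 3)) = 3 := by ring
  have n6 : ((c : ℝ) + 6 - (c + 4)) = 2 := by ring
  rw [n1, n2, n3, n4, n5, n6, mul_one]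
  ring

/-- ★★ **CONJECTURE W AT `K = 4` ON THE SUPPORTS `(c, c+3, c+4, c+6)`**: `Z₊(W(u,v)) ≤ 4` for all real `u, v`. [this work] -/
theorem card_posRoots_wronskian_four_le_four_spreadSixA (u v : Fin 4 → ℝ) (c : ℕ) :
    ((wronskian (∑ l, C (u l) * (X : ℝ[X]) ^ (![c, c + 3, c + 4, c + 6] : Fin 4 → ℕ) l)
        (∑ l, C (v l) * (X : ℝ[X]) ^ (![c, c + 3, c + 4, c + 6] : Fin 4 → ℕ) l)).roots.toFinset.filter
      (fun x => 0 < x)).card ≤ 4 := by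
  classical
  have hdm : StrictMono (![c, c + 3, c + 4, c + 6] : Fin 4 → ℕ) := by
    refine Fin.strictMono_iff_lt_succ.mpr fun i => ?_
    fin_cases i <;> simp
  have hA : (![c, c + 3, c + 4, c + 6] : Fin 4 → ℕ) 0 + (![c, c + 3, c + 4, c + 6] : Fin 4 → ℕ) 3 <
      (![c, c + 3, c + 4, c + 6] : Fin 4 → ℕ) 1 + (![c, c + 3, c + 4, c + 6] : Fin 4 → ℕ) 2 := by
    simp; omega
  set W : ℝ[X] := wronskian (∑ l, C (u l) * (X : ℝ[X]) ^ (![c, c + 3, c + 4, c + 6] : Fin 4 → ℕ) l)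
        (∑ l, C (v l) * (X : ℝ[X]) ^ (![c, c + 3, c + 4, c + 6] : Fin 4 → ℕ) l) with hW
  have hXW := X_mul_wronskian_spreadSixA_eq u v c
  rw [← hW] at hXW
  by_contra hgt
  have h5 : 5 ≤ (W.roots.toFinset.filter (fun x => 0 < x)).card := by omega
  by_cases hp23z : u 2 * v 3 - u 3 * v 2 = 0
  · have h4 := card_posRoots_wronskian_four_le_four_of_consecutive_nonneg u v _ hdm hA 4 (by norm_num) (by
      simp [hp23z])
    exact hgt h4
  set q0 := (u 0 * v 1 - u 1 * v 0) * 3 with hq0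
  set q1 := (u 0 * v 2 - u 2 * v 0) * 4 with hq1
  set q3 := (u 0 * v 3 - u 3 * v 0) * 6 with hq3
  set q4 := u 1 * v 2 - u 2 * v 1 with hq4
  set q6 := (u 1 * v 3 - u 3 * v 1) * 3 with hq6
  set q7 := (u 2 * v 3 - u 3 * v 2) * 2 with hq7
  set Q : ℝ[X] := C q0 + C q1 * X + C q3 * X ^ 3 + C q4 * X ^ 4 + C q6 * X ^ 6 + C q7 * X ^ 7 with hQ
  have hW0 : W ≠ 0 := by
    intro h0; rw [h0, roots_zero] at h5; simp at h5
  have hQ0 : Q ≠ 0 := by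
    intro h0
    rw [h0, mul_zero] at hXW
    exact hW0 ((mul_eq_zero.mp hXW).resolve_left X_ne_zero)
  have hq7ne : q7 ≠ 0 := by rw [hq7]; exact mul_ne_zero hp23z two_ne_zero
  have hdegQ : Q.natDegree = 7 := by
    refine natDegree_eq_of_le_of_coeff_ne_zero (by rw [hQ]; compute_degree!) ?_
    have : Q.coeff 7 = q7 := by rw [hQ]; simp
    rw [this]; exact hq7ne
  -- five distinct positive zeros of `W`, all roots of `Q`
  obtain ⟨T, hTS, hT⟩ := Finset.exists_subset_card_eq h5
  have hTpos : ∀ x ∈ T, 0 < x := fun x hx => (Finset.mem_filter.mp (hTS hx)).2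
  have hTQ : ∀ x ∈ T, Q.IsRoot x := by
    intro x hx
    have hxW : W.IsRoot x := by
      have h := (Finset.mem_filter.mp (hTS hx)).1
      rw [Multiset.mem_toFinset] at h
      exact (mem_roots hW0).mp h
    have h1 : ((X : ℝ[X]) * W).eval x = 0 := by rw [eval_mul, hxW.eq_zero, mul_zero]
    rw [hXW, eval_mul, eval_pow, eval_X] at h1
    rcases mul_eq_zero.mp h1 with h | h
    · exact absurd (pow_eq_zero_iff (by omega) |>.mp h) (hTpos x hx).ne'
    · exact h
  have hTle : T.val ≤ Q.roots := by
    rw [Multiset.le_iff_subset T.nodup]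
    intro x hx
    exact (mem_roots hQ0).mpr (hTQ x hx)
  obtain ⟨R2, hQR⟩ := (Multiset.prod_X_sub_C_dvd_iff_le_roots hQ0 T.val).mpr hTle
  set P5 : ℝ[X] := (T.val.map fun a => X - C a).prod with hP5
  have hP5deg : P5.natDegree = 5 := by
    rw [hP5, natDegree_multiset_prod_X_sub_C_eq_card, Finset.card_val, hT]
  have hP5ne : P5 ≠ 0 := (monic_multisetProd_X_sub_C T.val).ne_zero
  have hRne : R2 ≠ 0 := by
    intro h0; rw [h0, mul_zero] at hQR; exact hQ0 hQR
  have hRdeg : R2.natDegree = 2 := by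
    have := natDegree_mul hP5ne hRne
    rw [← hQR, hdegQ, hP5deg] at this
    omega
  have hRform : R2 = C (R2.coeff 0) + C (R2.coeff 1) * X + C (R2.coeff 2) * X ^ 2 := by
    have h := R2.as_sum_range_C_mul_X_pow
    rw [hRdeg] at h
    rw [h]
    simp [Finset.sum_range_succ]
  set c0 := R2.coeff 0 with hc0def
  set c1 := R2.coeff 1 with hc1def
  set c2 := R2.coeff 2 with hc2def
  set r : Fin 5 → ℝ := fun m => T.orderEmbOfFin hT m with hr_def
  have hr : StrictMono r := fun i j hij => (T.orderEmbOfFin hT).strictMono hij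
  have hrT : ∀ m, r m ∈ T := fun m => Finset.orderEmbOfFin_mem T hT m
  have hr0 : ∀ m, 0 < r m := fun m => hTpos _ (hrT m)
  have hs5 : T.val = r 0 ::ₘ r 1 ::ₘ r 2 ::ₘ r 3 ::ₘ r 4 ::ₘ 0 := by
    symm
    refine Multiset.eq_of_le_of_card_le ?_ ?_
    · rw [Multiset.le_iff_subset (by simp [Multiset.nodup_cons, hr.injective.eq_iff])]
      intro x hx
      simp only [Multiset.mem_cons, Multiset.notMem_zero, or_false] at hx
      rcases hx with h | h | h | h | h <;> (rw [h]; exact hrT _)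
    · simp [hT]
  have hP5prod : P5 = (X - C (r 0)) * ((X - C (r 1)) * ((X - C (r 2)) * ((X - C (r 3)) * (X - C (r 4))))) := by
    rw [hP5, hs5]; simp
  obtain ⟨e1, he1⟩ : ∃ e1 : ℝ, e1 = (r 0 + r 1 + r 2 + r 3 + r 4) := ⟨_, rfl⟩
  obtain ⟨e2, he2⟩ : ∃ e2 : ℝ, e2 = (r 0 * r 1 + r 0 * r 2 + r 0 * r 3 + r 0 * r 4 + r 1 * r 2 + r 1 * r 3 + r 1 * r 4 + r 2 * r 3 + r 2 * r 4 + r 3 * r 4) := ⟨_, rfl⟩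
  obtain ⟨e3, he3⟩ : ∃ e3 : ℝ, e3 = (r 0 * r 1 * r 2 + r 0 * r 1 * r 3 + r 0 * r 1 * r 4 + r 0 * r 2 * r 3 + r 0 * r 2 * r 4 + r 0 * r 3 * r 4 +
      r 1 * r 2 * r 3 + r 1 * r 2 * r 4 + r 1 * r 3 * r 4 + r 2 * r 3 * r 4) := ⟨_, rfl⟩
  obtain ⟨e4, he4⟩ : ∃ e4 : ℝ, e4 = (r 0 * r 1 * r 2 * r 3 + r 0 * r 1 * r 2 * r 4 + r 0 * r 1 * r 3 * r 4 + r 0 * r 2 * r 3 * r 4 + r 1 * r 2 * r 3 * r 4) := ⟨_, rfl⟩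
  obtain ⟨e5, he5⟩ : ∃ e5 : ℝ, e5 = (r 0 * r 1 * r 2 * r 3 * r 4) := ⟨_, rfl⟩
  have hprod : Q = C (-(e5 * c0)) + C (e4 * c0 - e5 * c1) * X + C (-(e3 * c0) + e4 * c1 - e5 * c2) * X ^ 2 +
      C (e2 * c0 - e3 * c1 + e4 * c2) * X ^ 3 + C (-(e1 * c0) + e2 * c1 - e3 * c2) * X ^ 4 +
      C (c0 - e1 * c1 + e2 * c2) * X ^ 5 + C (c1 - e1 * c2) * X ^ 6 + C c2 * X ^ 7 := by
    rw [hQR, hP5prod, hRform]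
    exact prod_quintic_quadratic r c0 c1 c2 e1 e2 e3 e4 e5 he1 he2 he3 he4 he5
  generalize hb0 : -(e5 * c0) = b0 at hprod
  generalize hb1 : e4 * c0 - e5 * c1 = b1 at hprod
  generalize hb2 : -(e3 * c0) + e4 * c1 - e5 * c2 = b2 at hprod
  generalize hb3 : e2 * c0 - e3 * c1 + e4 * c2 = b3 at hprod
  generalize hb4 : -(e1 * c0) + e2 * c1 - e3 * c2 = b4 at hprod
  generalize hb5 : c0 - e1 * c1 + e2 * c2 = b5 at hprod
  generalize hb6 : c1 - e1 * c2 = b6 at hprod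
  obtain ⟨R0, R1, R2', R3, R4, R5, R6, R7⟩ := coeff_octic_form b0 b1 b2 b3 b4 b5 b6 c2
  obtain ⟨L0, L1, L2, L3, L4, L5, L6, L7⟩ := coeff_sixA_form q0 q1 q3 q4 q6 q7
  have kc : ∀ j : ℕ, Q.coeff j = (C b0 + C b1 * X + C b2 * X ^ 2 + C b3 * X ^ 3 + C b4 * X ^ 4 + C b5 * X ^ 5 + C b6 * X ^ 6 +
      C c2 * X ^ 7 : ℝ[X]).coeff j := fun j => by rw [hprod]
  have k0 : q0 = b0 := by have := kc 0; rw [hQ, L0, R0] at this; exact this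
  have k1 : q1 = b1 := by have := kc 1; rw [hQ, L1, R1] at this; exact this
  have k2 : (0:ℝ) = b2 := by have := kc 2; rw [hQ, L2, R2'] at this; exact this
  have k3 : q3 = b3 := by have := kc 3; rw [hQ, L3, R3] at this; exact this
  have k4 : q4 = b4 := by have := kc 4; rw [hQ, L4, R4] at this; exact this
  have k5 : (0:ℝ) = b5 := by have := kc 5; rw [hQ, L5, R5] at this; exact this
  have k6 : q6 = b6 := by have := kc 6; rw [hQ, L6, R6] at this; exact this
  have k7 : q7 = c2 := by have := kc 7; rw [hQ, L7, R7] at this; exact this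
  rw [← hb0] at k0; rw [← hb1] at k1; rw [← hb2] at k2; rw [← hb3] at k3; rw [← hb4] at k4; rw [← hb5] at k5
  rw [← hb6] at k6
  -- the Plücker relation `p₀₁p₂₃ − p₀₂p₁₃ + p₀₃p₁₂ = 0`, times `12`
  have plucker : 2 * q0 * q7 - q1 * q6 + 2 * q3 * q4 = 0 := by
    rw [hq0, hq1, hq3, hq4, hq6, hq7]; ring
  exact spreadSixA_algebra r hr0 e1 e2 e3 e4 e5 he1 he2 he3 he4 he5 c0 c1 c2 q0 q1 q3 q4 q6 q7 k0 k1 k2 k3 k4 k5 k6 k7 hq7ne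
    plucker

/-- ★★ **CONJECTURE W AT `K = 4` ON THE SUPPORTS `(c, c+3h, c+4h, c+6h)`** (`h ≥ 1`). [this work] -/
theorem card_posRoots_wronskian_four_le_four_spreadSixA_scaled (u v : Fin 4 → ℝ) (c h : ℕ) (hh : 0 < h) :
    ((wronskian (∑ l, C (u l) * (X : ℝ[X]) ^ (![c, c + 3 * h, c + 4 * h, c + 6 * h] : Fin 4 → ℕ) l)
        (∑ l, C (v l) * (X : ℝ[X]) ^ (![c, c + 3 * h, c + 4 * h, c + 6 * h] : Fin 4 → ℕ) l)).roots.toFinset.filter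
      (fun x => 0 < x)).card ≤ 4 := by
  have hfun : (![c, c + 3 * h, c + 4 * h, c + 6 * h] : Fin 4 → ℕ) = fun l => c + h * (![0, 3, 4, 6] : Fin 4 → ℕ) l := by
    funext l; fin_cases l <;> simp <;> ring
  rw [hfun]
  refine (card_posRoots_wronskian_scaled_le u v _ c h hh).trans ?_
  have h0 : (![0, 3, 4, 6] : Fin 4 → ℕ) = ![0, 0 + 3, 0 + 4, 0 + 6] := by norm_num
  rw [h0]
  exact card_posRoots_wronskian_four_le_four_spreadSixA u v 0

/-- ★★ **CONJECTURE W AT `K = 4` ON THE MIRROR SUPPORTS `(c, c+2h, c+3h, c+6h)`** (`h ≥ 1`). [this work] -/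
theorem card_posRoots_wronskian_four_le_four_spreadSixA_mirror (u v : Fin 4 → ℝ) (c h : ℕ) (hh : 0 < h) :
    ((wronskian (∑ l, C (u l) * (X : ℝ[X]) ^ (![c, c + 2 * h, c + 3 * h, c + 6 * h] : Fin 4 → ℕ) l)
        (∑ l, C (v l) * (X : ℝ[X]) ^ (![c, c + 2 * h, c + 3 * h, c + 6 * h] : Fin 4 → ℕ) l)).roots.toFinset.filter
      (fun x => 0 < x)).card ≤ 4 := by
  set d : Fin 4 → ℕ := ![c, c + 2 * h, c + 3 * h, c + 6 * h] with hd
  have hD : ∀ l, d l ≤ c + 6 * h := by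
    intro l; fin_cases l <;> simp [hd] <;> omega
  refine (card_posRoots_wronskian_le_reflect u v d (c + 6 * h) hD).trans ?_
  have hexp : ∀ l : Fin 4, c + 6 * h - d (Fin.rev l) = 0 + h * (![0, 3, 4, 6] : Fin 4 → ℕ) l := by
    intro l
    fin_cases l
    · show c + 6 * h - d (Fin.rev 0) = 0 + h * 0
      rw [show Fin.rev (0 : Fin 4) = 3 by decide]; simp [hd]
    · show c + 6 * h - d (Fin.rev 1) = 0 + h * 3
      rw [show Fin.rev (1 : Fin 4) = 2 by decide]; simp [hd]; omega
    · show c + 6 * h - d (Fin.rev 2) = 0 + h * 4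
      rw [show Fin.rev (2 : Fin 4) = 1 by decide]; simp [hd]; omega
    · show c + 6 * h - d (Fin.rev 3) = 0 + h * 6
      rw [show Fin.rev (3 : Fin 4) = 0 by decide]; simp [hd]; omega
  simp_rw [hexp]
  refine (card_posRoots_wronskian_scaled_le (fun l => u (Fin.rev l)) (fun l => v (Fin.rev l)) _ 0 h hh).trans ?_
  have h0 : (![0, 3, 4, 6] : Fin 4 → ℕ) = ![0, 0 + 3, 0 + 4, 0 + 6] := by norm_num
  rw [h0]
  exact card_posRoots_wronskian_four_le_four_spreadSixA _ _ 0

end WronskianDevelopable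

end Summit.ValiantsHypothesis.ValiantsHypothesis.Theorems.KPlusLogSqLaw.TowerGraft
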